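import Summits.Ventures.LatticeQCDFlow.Scoring.U1TorusCharacterFormula
import Summits.Ventures.LatticeQCDFlow.Scoring.U1OpenLatticeWilsonLoops
import HarnessLib

/-!
# Wilson loops of arbitrary area on the 2-d `U(1)` torus: `⟨cos θ(∂A)⟩ = Σ_k I_k^{V−a}(I_{k−1}^a + I_{k+1}^a)/(2 Σ_k I_k^V)`

HONEST FRAMING: exact (Metropolis-corrected) sampling algorithms for lattice gauge theory;
figures of merit are autocorrelation/cost numbers at stated couplings and volumes; no
continuum-physics claim.

Venture `LatticeQCDFlow` (cell pub-lqcd), sub-topic `Scoring`; FANOUT row 5 (`s0-sun-a`), GEN-8.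
NEW WORK of the cell (placement rule).  `Scoring/U1TorusCharacterFormula.lean` (GEN-7) computes the
ONE-plaquette expectation of the `L₁ × L₂` torus and lists "Wilson loops larger than one plaquette"
as NOT typed.  With the lattice Stokes identity of `Scoring/U1OpenLatticeWilsonLoops.lean`
(`Σ_{p∈A} θ_p = Σ_l (∂A)_l θ_l`) this file computes the Wilson loop of the boundary of EVERY set
`A` of plaquettes on every closed connected complex:

* `linkConstraint_region_iff_mem_range`, `setIntegral_cexp_region_mul_weight` — the probe
  character `e^{is Σ_{p∈A} θ_p}` selects the dual assignments `m = k − s·𝟙_A`, `k ∈ ℤ`;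
* **`u1WilsonExpect_cos_boundary`** — `⟨cos θ(∂A)⟩ = Σ_k (∏_{p∉A} I_{|k|}(β_p))·
  (∏_{p∈A} I_{|k−1|}(β_p) + ∏_{p∈A} I_{|k+1|}(β_p))/2 / Σ_k ∏_p I_{|k|}(β_p)`;
* **`torus_u1WilsonExpect_cos_boundary`** — on the `L₁ × L₂` torus at uniform `β`, with
  `a = #A`, `V = L₁L₂`: `⟨cos θ(∂A)⟩_{L₁×L₂,β} = Σ_k I_{|k|}^{V−a}(I_{|k−1|}^a + I_{|k+1|}^a)/2 / Σ_k I_{|k|}^V`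
  — the value depends on the region only through its AREA `a` (perimeter-free, shape-free), and
  reduces to GEN-7's formula at `a = 1` and to `1` at `A = Λ` (`∂Λ = 0`).  This is the exact torus
  Wilson-loop table of the cell's X02 oracle (`wilson_loops`, finite volume).

Elementary; nothing is cited (classical 2-d character expansion, Migdal 1975).
-/

noncomputable section

open scoped Nat
open Real MeasureTheory Set Finset Literature.Analysis.FunctionSpaces

namespace Summit.Ventures.LatticeQCDFlow.Scoring

section Closed

variable {n : ℕ} {ι : Type*} [Fintype ι] [DecidableEq ι] (inc : ι → Fin (n + 1) → ℤ) (βp : ι → ℝ)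

/-- `s·(∂A)_l = Σ_p s·𝟙_A(p)·inc p l`. -/
theorem mul_boundaryChain_eq_sum (A : Finset ι) (s : ℤ) (l : Fin (n + 1)) :
    s * boundaryChain inc A l = ∑ p, (if p ∈ A then s else 0) * inc p l := by
  rw [boundaryChain, Finset.mul_sum]
  have h : ∀ p, (if p ∈ A then s else 0) * inc p l = if p ∈ A then s * inc p l else 0 := by
    intro p; split_ifs <;> simp
  simp_rw [h, Finset.sum_ite_mem, Finset.univ_inter]

/-- On a closed connected complex, the dual assignments compatible with the probe `s·∂A` are
exactly `m = k − s·𝟙_A`, `k ∈ ℤ`. -/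
theorem linkConstraint_region_iff_mem_range [Nonempty ι] (hclosed : ∀ l, ∑ p, inc p l = 0)
    (hconn : ∀ m : ι → ℤ, (∀ l, ∑ p, m p * inc p l = 0) → ∀ p q, m p = m q)
    (A : Finset ι) (s : ℤ) (m : ι → ℤ) :
    (∀ l, s * boundaryChain inc A l + ∑ p, m p * inc p l = 0) ↔
      m ∈ Set.range fun k : ℤ => fun p => k - if p ∈ A then s else 0 := by
  obtain ⟨p₀⟩ := ‹Nonempty ι›
  constructor
  · intro h
    have h' : ∀ l, ∑ p, (m p + if p ∈ A then s else 0) * inc p l = 0 := by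
      intro l
      have := h l
      rw [mul_boundaryChain_eq_sum] at this
      simp only [add_mul, Finset.sum_add_distrib]
      linarith
    refine ⟨m p₀ + if p₀ ∈ A then s else 0, funext fun p => ?_⟩
    have hc := hconn _ h' p p₀
    simp only at hc ⊢
    linarith
  · rintro ⟨k, rfl⟩ l
    rw [mul_boundaryChain_eq_sum]
    simp only [sub_mul, Finset.sum_sub_distrib, ← Finset.mul_sum, hclosed, mul_zero, zero_sub,
      add_neg_cancel]

omit [Fintype ι] in
/-- The parametrisation `k ↦ k − s·𝟙_A` is injective. -/
theorem injective_const_sub_ite_mem [Nonempty ι] (A : Finset ι) (s : ℤ) :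
    Function.Injective fun k : ℤ => fun p : ι => k - if p ∈ A then s else 0 := by
  obtain ⟨p₀⟩ := ‹Nonempty ι›
  intro k k' h
  have := congr_fun h p₀
  simpa using this

/-- **Probe character of a region**:
`∫ e^{i s Σ_{p∈A} θ_p} W dθ = (2π)^{n+1} Σ_{k ∈ ℤ} ∏_p I_{|k − s·𝟙_A(p)|}(β_p)`. -/
theorem setIntegral_cexp_region_mul_weight [Nonempty ι] (hclosed : ∀ l, ∑ p, inc p l = 0)
    (hconn : ∀ m : ι → ℤ, (∀ l, ∑ p, m p * inc p l = 0) → ∀ p q, m p = m q)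
    (A : Finset ι) (s : ℤ) :
    ∫ θ in u1TorusBox (n + 1),
        Complex.exp ((s : ℂ) * (∑ p ∈ A, (u1PlaqAngle inc p θ : ℂ)) * Complex.I) *
          ((u1WilsonWeight univ inc βp θ : ℝ) : ℂ) =
      (2 * π : ℂ) ^ (n + 1) *
        ∑' k : ℤ, ∏ p, (besselI (k - if p ∈ A then s else 0).natAbs (βp p) : ℂ) := by
  have hphase : ∀ θ : Fin (n + 1) → ℝ, (s : ℂ) * (∑ p ∈ A, (u1PlaqAngle inc p θ : ℂ)) * Complex.I =
      (∑ l, ((s * boundaryChain inc A l : ℤ) : ℂ) * θ l) * Complex.I := fun θ => by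
    rw [← Complex.ofReal_sum, sum_u1PlaqAngle_eq_boundary]
    push_cast
    rw [Finset.mul_sum]
    congr 1
    exact Finset.sum_congr rfl fun l _ => by ring
  simp_rw [hphase]
  rw [setIntegral_cexp_mul_u1WilsonWeight inc βp fun l => s * boundaryChain inc A l]
  congr 1
  exact tsum_ite_eq_tsum_of_range _ (injective_const_sub_ite_mem A s)
    (linkConstraint_region_iff_mem_range inc hclosed hconn A s)

/-- Splitting the product over `A` and its complement:
`∏_p I_{|k − s𝟙_A(p)|}(β_p) = (∏_{p∈A} I_{|k−s|}(β_p)) · ∏_{p∉A} I_{|k|}(β_p)`. -/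
theorem prod_besselI_sub_ite_mem (A : Finset ι) (k s : ℤ) :
    ∏ p, besselI (k - if p ∈ A then s else 0).natAbs (βp p) =
      (∏ p ∈ A, besselI (k - s).natAbs (βp p)) * ∏ p ∈ univ \ A, besselI k.natAbs (βp p) := by
  rw [← Finset.prod_sdiff (Finset.subset_univ A), mul_comm]
  congr 1
  · exact Finset.prod_congr rfl fun p hp => by rw [if_pos hp]
  · exact Finset.prod_congr rfl fun p hp => by rw [if_neg (Finset.mem_sdiff.mp hp).2, sub_zero]

/-- The shifted products are summable over `k`. -/
theorem summable_prod_besselI_sub_ite_mem [Nonempty ι] (A : Finset ι) (s : ℤ) :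
    Summable fun k : ℤ => ∏ p, besselI (k - if p ∈ A then s else 0).natAbs (βp p) := by
  have h := ((summable_norm_prod_besselI βp).of_norm.comp_injective
    (injective_const_sub_ite_mem A s))
  have h2 := Complex.reCLM.summable h
  refine h2.congr fun k => ?_
  simp only [Function.comp_apply, Complex.reCLM_apply, ← Complex.ofReal_prod, Complex.ofReal_re]

/-- **The Wilson-loop numerator of a region on a closed connected complex.** -/
theorem setIntegral_cos_region_mul_weight [Nonempty ι] (hclosed : ∀ l, ∑ p, inc p l = 0)
    (hconn : ∀ m : ι → ℤ, (∀ l, ∑ p, m p * inc p l = 0) → ∀ p q, m p = m q) (A : Finset ι) :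
    ∫ θ in u1TorusBox (n + 1),
        Real.cos (∑ p ∈ A, u1PlaqAngle inc p θ) * u1WilsonWeight univ inc βp θ =
      (2 * π) ^ (n + 1) * ∑' k : ℤ, (∏ p ∈ univ \ A, besselI k.natAbs (βp p)) *
        (((∏ p ∈ A, besselI (k - 1).natAbs (βp p)) + ∏ p ∈ A, besselI (k + 1).natAbs (βp p)) / 2) := by
  have hW := continuous_u1WilsonWeight univ inc βp
  have hA := fun p => continuous_u1PlaqAngle inc p
  have hI : ∀ s : ℤ, Integrable (fun θ : Fin (n + 1) → ℝ =>
      Complex.exp ((s : ℂ) * (∑ p ∈ A, (u1PlaqAngle inc p θ : ℂ)) * Complex.I) *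
        ((u1WilsonWeight univ inc βp θ : ℝ) : ℂ))
      ((volume : Measure (Fin (n + 1) → ℝ)).restrict (u1TorusBox (n + 1))) := fun s =>
    integrableOn_u1TorusBox' (by fun_prop)
  have h1 := setIntegral_cexp_region_mul_weight inc βp hclosed hconn A 1
  have h2 := setIntegral_cexp_region_mul_weight inc βp hclosed hconn A (-1)
  apply Complex.ofReal_injective
  rw [← integral_complex_ofReal]
  have hsplit : ∀ θ : Fin (n + 1) → ℝ,
      (((Real.cos (∑ p ∈ A, u1PlaqAngle inc p θ) * u1WilsonWeight univ inc βp θ : ℝ)) : ℂ) =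
        (1 / 2 : ℂ) * (Complex.exp (((1 : ℤ) : ℂ) * (∑ p ∈ A, (u1PlaqAngle inc p θ : ℂ)) * Complex.I) *
            ((u1WilsonWeight univ inc βp θ : ℝ) : ℂ)) +
          (1 / 2 : ℂ) * (Complex.exp (((-1 : ℤ) : ℂ) * (∑ p ∈ A, (u1PlaqAngle inc p θ : ℂ)) * Complex.I) *
            ((u1WilsonWeight univ inc βp θ : ℝ) : ℂ)) := fun θ => by
    push_cast
    rw [Complex.cos]
    ring_nf
  simp_rw [hsplit]
  rw [integral_add ((hI 1).const_mul _) ((hI (-1)).const_mul _), MeasureTheory.integral_const_mul,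
    MeasureTheory.integral_const_mul, h1, h2]
  have hs1 := summable_prod_besselI_sub_ite_mem βp A 1
  have hs2 := summable_prod_besselI_sub_ite_mem βp A (-1)
  have key : ∑' k : ℤ, (∏ p ∈ univ \ A, besselI k.natAbs (βp p)) *
        (((∏ p ∈ A, besselI (k - 1).natAbs (βp p)) + ∏ p ∈ A, besselI (k + 1).natAbs (βp p)) / 2) =
      1 / 2 * ∑' k : ℤ, ∏ p, besselI (k - if p ∈ A then (1 : ℤ) else 0).natAbs (βp p) +
        1 / 2 * ∑' k : ℤ, ∏ p, besselI (k - if p ∈ A then (-1 : ℤ) else 0).natAbs (βp p) := by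
    rw [← tsum_mul_left, ← tsum_mul_left, ← (hs1.mul_left _).tsum_add (hs2.mul_left _)]
    refine tsum_congr fun k => ?_
    rw [prod_besselI_sub_ite_mem, prod_besselI_sub_ite_mem, sub_neg_eq_add]
    ring
  have hreal : (2 * π) ^ (n + 1) * ∑' k : ℤ, (∏ p ∈ univ \ A, besselI k.natAbs (βp p)) *
        (((∏ p ∈ A, besselI (k - 1).natAbs (βp p)) + ∏ p ∈ A, besselI (k + 1).natAbs (βp p)) / 2) =
      1 / 2 * ((2 * π) ^ (n + 1) *
          ∑' k : ℤ, ∏ p, besselI (k - if p ∈ A then (1 : ℤ) else 0).natAbs (βp p)) +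
        1 / 2 * ((2 * π) ^ (n + 1) *
          ∑' k : ℤ, ∏ p, besselI (k - if p ∈ A then (-1 : ℤ) else 0).natAbs (βp p)) := by
    rw [key]; ring
  rw [hreal]
  push_cast
  ring

/-- **The Wilson loop of the boundary of a region on a closed connected complex**:
`⟨cos θ(∂A)⟩ = Σ_k (∏_{p∉A} I_{|k|}(β_p))(∏_{p∈A} I_{|k−1|}(β_p) + ∏_{p∈A} I_{|k+1|}(β_p))/2 / Σ_k ∏_p I_{|k|}(β_p)`. -/
theorem u1WilsonExpect_cos_boundary [Nonempty ι] (hclosed : ∀ l, ∑ p, inc p l = 0)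
    (hconn : ∀ m : ι → ℤ, (∀ l, ∑ p, m p * inc p l = 0) → ∀ p q, m p = m q) (A : Finset ι) :
    u1WilsonExpect univ inc βp (fun θ => Real.cos (∑ l, (boundaryChain inc A l : ℝ) * θ l)) =
      (∑' k : ℤ, (∏ p ∈ univ \ A, besselI k.natAbs (βp p)) *
        (((∏ p ∈ A, besselI (k - 1).natAbs (βp p)) + ∏ p ∈ A, besselI (k + 1).natAbs (βp p)) / 2)) /
        ∑' k : ℤ, ∏ p, besselI k.natAbs (βp p) := by
  have hfun : (fun θ : Fin (n + 1) → ℝ => Real.cos (∑ l, (boundaryChain inc A l : ℝ) * θ l)) =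
      fun θ => Real.cos (∑ p ∈ A, u1PlaqAngle inc p θ) := by
    funext θ; rw [sum_u1PlaqAngle_eq_boundary]
  rw [hfun, u1WilsonExpect, setIntegral_cos_region_mul_weight inc βp hclosed hconn A,
    u1WilsonZ_eq_tsum_const inc βp hclosed hconn,
    mul_div_mul_left _ _ (by positivity : (2 * π : ℝ) ^ (n + 1) ≠ 0)]

/-- **Uniform coupling**: with `a = #A` and `V = #ι`,
`⟨cos θ(∂A)⟩ = Σ_k I_{|k|}^{V−a}(I_{|k−1|}^a + I_{|k+1|}^a)/2 / Σ_k I_{|k|}^V` — the Wilson loop depends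
on the region only through its area. -/
theorem u1WilsonExpect_cos_boundary_uniform [Nonempty ι] (hclosed : ∀ l, ∑ p, inc p l = 0)
    (hconn : ∀ m : ι → ℤ, (∀ l, ∑ p, m p * inc p l = 0) → ∀ p q, m p = m q) (β : ℝ) (A : Finset ι) :
    u1WilsonExpect univ inc (fun _ => β) (fun θ => Real.cos (∑ l, (boundaryChain inc A l : ℝ) * θ l)) =
      (∑' k : ℤ, besselI k.natAbs β ^ (Fintype.card ι - A.card) *
          ((besselI (k - 1).natAbs β ^ A.card + besselI (k + 1).natAbs β ^ A.card) / 2)) /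
        ∑' k : ℤ, besselI k.natAbs β ^ Fintype.card ι := by
  rw [u1WilsonExpect_cos_boundary inc _ hclosed hconn A]
  simp only [Finset.prod_const, Finset.card_sdiff_of_subset (Finset.subset_univ A), Finset.card_univ]

end Closed

/-! ### The `L₁ × L₂` torus -/

section Torus

variable {L₁ L₂ : ℕ} [NeZero L₁] [NeZero L₂] {n : ℕ}
  (e : Fin 2 × (Fin L₁ × Fin L₂) ≃ Fin (n + 1))

/-- **WILSON LOOPS OF THE 2-d `U(1)` TORUS.**  For every `L₁, L₂ ≥ 1`, every real `β` and every
set `A` of plaquettes with `a = #A`, the loop around `∂A` has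
`⟨cos θ(∂A)⟩_{L₁×L₂,β} = Σ_k I_{|k|}(β)^{L₁L₂−a}(I_{|k−1|}(β)^a + I_{|k+1|}(β)^a)/2 / Σ_k I_{|k|}(β)^{L₁L₂}`. -/
theorem torus_u1WilsonExpect_cos_boundary (β : ℝ) (A : Finset (Fin L₁ × Fin L₂)) :
    u1WilsonExpect univ (torusInc e) (fun _ => β)
        (fun θ => Real.cos (∑ l, (boundaryChain (torusInc e) A l : ℝ) * θ l)) =
      (∑' k : ℤ, besselI k.natAbs β ^ (L₁ * L₂ - A.card) *
          ((besselI (k - 1).natAbs β ^ A.card + besselI (k + 1).natAbs β ^ A.card) / 2)) /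
        ∑' k : ℤ, besselI k.natAbs β ^ (L₁ * L₂) := by
  rw [u1WilsonExpect_cos_boundary_uniform _ (torusInc_closed e) (torusInc_conn e)]
  simp [Fintype.card_prod, Fintype.card_fin]

end Torus

end Summit.Ventures.LatticeQCDFlow.Scoring
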